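import Summits.QuantumFields.YangMills.Theorems.BalabanUVNodesK0RecordFormatNamesLemmas10
import Summits.QuantumFields.YangMills.Theorems.BalabanUVNodesPortU8CurrentLinearisation
import Summits.QuantumFields.YangMills.Theorems.BalabanUVNodesPortU8IotaC2Transport
import Summits.QuantumFields.YangMills.Theorems.BalabanUVNodesPortS1Chart

/-!
# PORT PT-B (U8), g2 file 8 — RECEIPT (E4a) `ResponseRowAtL` PROVED: the FIRST DERIVATIVE of the dressed chart `recordEmbL` at `B = 0` on the basis fields IS the
# (21)-Landau response `recordGkL` (𝐔-block `Hr`, 𝐉-block unchanged) — the product rule through the dressing `u_B = exp(φ_B)` at the flat centre, under TokP9reg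
# (rooted entries `C²` at `0`) — `--supports stmt-QuantumFields-27931` (helper; JOIN-side receipt of DEF-1 ed.14b; NOT a closer)

Cell `ym-nodeO-ideate` ∕ `ym-balaban-port`, porter `ymgap-nodeO-port-PTB-1` (gen 2), item **stmt-QuantumFields-27931** `BalabanUVNodes.PortPieceLocalityU8` (v9-L ce176c41); DEF-1 ed.14b
`…K0RecordFormatNamesLDress` (receipt `ResponseRowAtL` DISPLAYED, «to be PROVED … under the TokP9-reg differentiability token and `recordBgField … 0 = 1`») + `…Lemmas10`.
[I] = [Balaban1987RG1], [15] = [Balaban1985Variational].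
WHAT IS PROVED (0 `sorry`, 0 `def`; standard axioms): §1 `recordPhi_add` ∕ `recordPhi_smul` (the traceless Landau potential is ℝ-LINEAR in the direction; DEF-1's
`recordDdir_add∕_smul`, `landauPotC_add∕_smul`), `differentiableAt_recordPhi`, `sl2Coord_one`; §2 the dressing along a line: `hasDerivAt_exp_recordPhi_line` ((e^{φ_{tδ}(x)})′(0) = φ_δ(x));
§3 ★★★ `responseRowAtL_of_tokP9reg (hk) (hε) (hd2) (a) : ResponseRowAtL F θ k K a` — for every label `l` and coordinate `i`,
`fderiv ℝ (recordEmbL F θ k K) 0 (δ_l ⊗ bV a) i = recordGkL F θ k K a l i`: the `𝐔`-coordinate derivative is `sl2Coord (D(b) + φ′(b₋) − φ′(b₊))` = `sl2Coord (Matrix.of (Hr b))`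
(`recordD_eq_recordHr_add`; the trace part of the potential is a multiple of `1`, invisible to `sl2Coord`); the `𝐉`-coordinate derivative is the rooted one (`J(W_0) = 0` kills the
dressing terms) = `recordGkJ` by definition.
HONEST FRAMING.  Matrix calculus at one point; TokP9reg is a HYPOTHESIS; nothing of Bałaban asserted; 27931 OPEN (close = (R4ᴰ)); K0⁷∕K-Ax OPEN; NODE O 0∕1; COUNT 8∕28 · K 1∕4 UNMOVED;
finite `𝕋⁴_{L^K}` at fixed ε — NOT continuum ∕ OS ∕ Clay; **the Yang–Mills mass gap (Clay) is NOT proved.**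
-/

noncomputable section

open scoped BigOperators Matrix.Norms.L2Operator
open NormedSpace (exp)

namespace Summit.QuantumFields.YangMills.Theorems.PortU8

open Literature.MathematicalPhysics.QuantumFieldTheory.Balaban1983to89
open Literature.MathematicalPhysics.QuantumFieldTheory.Balaban1983to89.Node00
open Literature.MathematicalPhysics.QuantumFieldTheory.Balaban1983to89.T4Continuum (T4Family)
open Summit.QuantumFields.YangMills.Theorems.K0RecordFormatNames
open Summit.QuantumFields.YangMills.Theorems.BalabanUVNodesPortS1 (sl2Proj_apply)

variable (F : T4Family) (θ : Stage13Params F 2)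

/-! ## §1  The traceless Landau potential is ℝ-linear in the direction -/

/-- `recordPhi` is ADDITIVE in the direction `B`. [cite: Balaban1985Variational, (21) p.281; Balaban1984PropagatorsII, (2.12) p.225 (bookkeeping)] -/
theorem recordPhi_add (k K : ℕ) (B B' : Fin (F.P K).d → Site (F.P K) (k + 1) → θ.Vβ) (x : Site (F.P K) 0) :
    letI := θ.instVβ₁; letI := θ.instVβ₂
    recordPhi F θ k K (B + B') x = recordPhi F θ k K B x + recordPhi F θ k K B' x := by
  letI := θ.instVβ₁; letI := θ.instVβ₂
  unfold recordPhi
  rw [← map_add]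
  congr 1
  ext i i'
  simp only [Matrix.of_apply, Matrix.add_apply, recordDdir_add, Pi.add_apply]
  rw [landauPotC_add]

/-- `recordPhi` is ℝ-HOMOGENEOUS in the direction `B`. [cite: Balaban1985Variational, (21) p.281; Balaban1984PropagatorsII, (2.12) p.225 (bookkeeping)] -/
theorem recordPhi_smul (k K : ℕ) (t : ℝ) (B : Fin (F.P K).d → Site (F.P K) (k + 1) → θ.Vβ) (x : Site (F.P K) 0) :
    letI := θ.instVβ₁; letI := θ.instVβ₂
    recordPhi F θ k K (t • B) x = t • recordPhi F θ k K B x := by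
  letI := θ.instVβ₁; letI := θ.instVβ₂
  unfold recordPhi
  rw [← Complex.coe_smul, ← map_smul]
  congr 1
  ext i i'
  simp only [Matrix.of_apply, Matrix.smul_apply, recordDdir_smul, Pi.smul_apply, Complex.real_smul, smul_eq_mul]
  rw [landauPotC_smul]

/-- `recordPhi 0 = 0`-based packaging: `B ↦ recordPhi B x` is DIFFERENTIABLE (a linear map on a finite-dimensional space). [cite: Balaban1985Variational, (21) p.281 (bookkeeping)] -/
theorem differentiableAt_recordPhi (k K : ℕ) (x : Site (F.P K) 0) (B₀ : Fin (F.P K).d → Site (F.P K) (k + 1) → θ.Vβ) :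
    letI := θ.instVβ₁; letI := θ.instVβ₂
    DifferentiableAt ℝ (fun B : Fin (F.P K).d → Site (F.P K) (k + 1) → θ.Vβ => recordPhi F θ k K B x) B₀ := by
  letI := θ.instVβ₁; letI := θ.instVβ₂; letI := θ.instιβ
  haveI : FiniteDimensional ℝ θ.Vβ := Module.Finite.of_basis θ.bV
  let ΦL : (Fin (F.P K).d → Site (F.P K) (k + 1) → θ.Vβ) →ₗ[ℝ] MatA 2 :=
    { toFun := fun B => recordPhi F θ k K B x
      map_add' := fun B B' => recordPhi_add F θ k K B B' x
      map_smul' := fun t B => recordPhi_smul F θ k K t B x }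
  exact (LinearMap.toContinuousLinearMap ΦL).differentiableAt

/-- `sl2Coord 1 = 0` (the identity has no traceless part). [cite: Balaban1987RG1, (1.10) p.262 (bookkeeping)] -/
theorem sl2Coord_one : sl2Coord (1 : MatA 2) = 0 := by
  ext a
  fin_cases a <;> simp [sl2Coord]

/-- `sl2Coord` does not see multiples of the identity. [cite: Balaban1987RG1, (1.10) p.262 (bookkeeping)] -/
theorem sl2Coord_add_smul_one (A : MatA 2) (κ : ℂ) (c : Fin 3) : sl2Coord (A + κ • (1 : MatA 2)) c = sl2Coord A c := by
  rw [sl2Coord_add, sl2Coord_smul, sl2Coord_one, smul_zero, add_zero]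

/-! ## §2  The dressing along a line through `0` -/

/-- **`(e^{φ_{tδ}(x)})′(0) = φ_δ(x)`** and **`(e^{−φ_{tδ}(x)})′(0) = −φ_δ(x)`** (ℝ-linearity of `recordPhi` + the derivative of `u ↦ exp (u • X)`).
[cite: Balaban1987RG1, (4.2) p.281, (1.10) p.262 (bookkeeping)] -/
theorem hasDerivAt_exp_recordPhi_line (k K : ℕ) (δ : Fin (F.P K).d → Site (F.P K) (k + 1) → θ.Vβ) (x : Site (F.P K) 0) :
    letI := θ.instVβ₁; letI := θ.instVβ₂
    HasDerivAt (fun t : ℝ => exp (recordPhi F θ k K (t • δ) x)) (recordPhi F θ k K δ x) 0 ∧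
      HasDerivAt (fun t : ℝ => exp (-recordPhi F θ k K (t • δ) x)) (-recordPhi F θ k K δ x) 0 := by
  letI := θ.instVβ₁; letI := θ.instVβ₂
  have hlin : ∀ t : ℝ, recordPhi F θ k K (t • δ) x = t • recordPhi F θ k K δ x := fun t => recordPhi_smul F θ k K t δ x
  constructor
  · have h := hasDerivAt_exp_smul_const' (𝕂 := ℝ) (recordPhi F θ k K δ x) (0 : ℝ)
    simp only [zero_smul, NormedSpace.exp_zero, mul_one] at h
    refine h.congr_of_eventuallyEq (Filter.Eventually.of_forall fun t => ?_)
    simp only [hlin]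
  · have h := hasDerivAt_exp_smul_const' (𝕂 := ℝ) (-recordPhi F θ k K δ x) (0 : ℝ)
    simp only [zero_smul, NormedSpace.exp_zero, mul_one] at h
    refine h.congr_of_eventuallyEq (Filter.Eventually.of_forall fun t => ?_)
    simp only [hlin, smul_neg]

/-! ## §3  Receipt (E4a): `fderiv recordEmbL 0 (δ_l ⊗ bV a) = recordGkL a l` -/

/-- ★★★ **RECEIPT (E4a) `ResponseRowAtL` PROVED under TokP9reg** (rooted entries `C²` at `0`; standing range `k + 1 ≤ m + K`, `0 < εbg`): for every label `l` and every two-block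
coordinate `i`, `fderiv ℝ (recordEmbL F θ k K) 0 (δ_l ⊗ bV a) i = recordGkL F θ k K a l i`.  𝐔-coordinates: the derivative of `log (u_B(b₋) U_B(b) u_B(b₊)⁻¹)` at `0` is
`D(b) + φ′(b₋) − φ′(b₊) = Hr(b) + (trace part)·1`, and `sl2Coord` kills the identity; 𝐉-coordinates: `J(W_0) = 0` kills both dressing terms, leaving the rooted `𝐉`-response
`= recordGkJ` by definition. [cite: Balaban1985Variational, Prop. 9 p.309, (21) p.281; Balaban1987RG1, (4.2) p.281, (4.35) p.290, (1.8)–(1.10) pp.261–262] -/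
theorem responseRowAtL_of_tokP9reg (k K : ℕ) (hk : k + 1 ≤ (F.P K).m + (F.P K).K) (hε : 0 < θ.εbg)
    (hd2 : letI := θ.instVβ₁; letI := θ.instVβ₂;
      ContDiffAt ℝ 2 (fun B : Fin (F.P K).d → Site (F.P K) (k + 1) → θ.Vβ =>
        fun (b : PBond (F.P K) 0) (i i' : Fin 2) => ((recordBgField F θ k K B b : SU 2) : MatA 2) i i') 0)
    (a : θ.ιβ) : ResponseRowAtL F θ k K a := by
  letI := θ.instVβ₁; letI := θ.instVβ₂; letI := θ.instιβ
  intro l i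
  set δ : Fin (F.P K).d → Site (F.P K) (k + 1) → θ.Vβ := Pi.single l.1 (Pi.single l.2 (θ.bV a)) with hδ
  -- the rooted data at `0`
  obtain ⟨U', hU'eq, hU'⟩ := hasFDerivAt_bgField_of_entries F θ k K (hd2.differentiableAt (by norm_num))
  have hE : DifferentiableAt ℝ (recordEmbJ F θ k K) 0 :=
    (contDiffAt_recordEmbJ_of F θ k K hk hε (contDiffAt_matrix_of_entries hd2)).differentiableAt (by norm_num)
  have hbg0 : ∀ b, ((recordBgField F θ k K 0 b : SU 2) : MatA 2) = 1 := fun b => by rw [recordBgField_zero F θ k K hk hε]; rfl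
  have hcur0 : ∀ b, recordCurrent F θ k K 0 b = 0 := fun b => by rw [recordCurrent_zero F θ k K hk hε]; rfl
  have hΦ0 : ∀ x, recordPhi F θ k K 0 x = 0 := fun x => recordPhi_zero F θ k K x
  -- the line `t ↦ t • δ`
  have hℓ : HasDerivAt (fun t : ℝ => t • δ) δ 0 := ((hasDerivAt_id (0 : ℝ)).smul_const δ).congr_deriv (one_smul ℝ δ)
  have hℓ0 : (fun t : ℝ => t • δ) 0 = 0 := zero_smul ℝ δ
  -- the rooted bond variable along the line: derivative `U′δ b = Matrix.of (recordD a l b)`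
  have hUℓ : HasDerivAt (fun t : ℝ => fun b' : PBond (F.P K) 0 => ((recordBgField F θ k K (t • δ) b' : SU 2) : MatA 2)) (U' δ) 0 :=
    hU'.comp_hasDerivAt_of_eq 0 hℓ hℓ0.symm
  have hWb : ∀ b : PBond (F.P K) 0, HasDerivAt (fun t : ℝ => ((recordBgField F θ k K (t • δ) b : SU 2) : MatA 2)) (U' δ b) 0 :=
    fun b => (hasDerivAt_pi.1 hUℓ) b
  have hUD : ∀ b, U' δ b = Matrix.of fun i₁ i₂ => recordD F θ k K a l b i₁ i₂ := fun b => by rw [hU'eq]; rfl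
  -- the current along the line (rooted), its derivative `Jd b`
  have hb2 : ∀ b, ContDiffAt ℝ 2 (fun B : Fin (F.P K).d → Site (F.P K) (k + 1) → θ.Vβ => ((recordBgField F θ k K B b : SU 2) : MatA 2)) 0 :=
    fun b => contDiffAt_pi.1 (contDiffAt_matrix_of_entries hd2) b
  have hW2 : ∀ b, ContDiffAt ℝ 2 (fun B : Fin (F.P K).d → Site (F.P K) (k + 1) → θ.Vβ => ((recordBgUnits F θ k K B b : (MatA 2)ˣ) : MatA 2)) 0 := hb2
  have hW2' : ∀ b, ContDiffAt ℝ 2 (fun B : Fin (F.P K).d → Site (F.P K) (k + 1) → θ.Vβ => (((recordBgUnits F θ k K B b)⁻¹ : (MatA 2)ˣ) : MatA 2)) 0 := by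
    intro b
    simp only [coe_recordBgUnits_inv]
    exact contDiff_star'.contDiffAt.comp 0 (hb2 b)
  have hJdiff : ∀ b, DifferentiableAt ℝ (fun B : Fin (F.P K).d → Site (F.P K) (k + 1) → θ.Vβ => recordCurrent F θ k K B b) 0 :=
    fun b => (contDiffAt_current hW2 hW2' sl2Proj ((F.P K).eta (k + 1)) b).differentiableAt (by norm_num)
  have hJℓ : ∀ b, HasDerivAt (fun t : ℝ => recordCurrent F θ k K (t • δ) b)
      (fderiv ℝ (fun B : Fin (F.P K).d → Site (F.P K) (k + 1) → θ.Vβ => recordCurrent F θ k K B b) 0 δ) 0 :=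
    fun b => (hJdiff b).hasFDerivAt.comp_hasDerivAt_of_eq 0 hℓ hℓ0.symm
  -- the dressing along the line
  have hux : ∀ x, HasDerivAt (fun t : ℝ => exp (recordPhi F θ k K (t • δ) x)) (recordPhi F θ k K δ x) 0 :=
    fun x => (hasDerivAt_exp_recordPhi_line F θ k K δ x).1
  have huix : ∀ x, HasDerivAt (fun t : ℝ => exp (-recordPhi F θ k K (t • δ) x)) (-recordPhi F θ k K δ x) 0 :=
    fun x => (hasDerivAt_exp_recordPhi_line F θ k K δ x).2
  -- the dressed pair, written out
  have hP1 : ∀ (B : Fin (F.P K).d → Site (F.P K) (k + 1) → θ.Vβ) (b : PBond (F.P K) 0),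
      (recordPairL F θ k K B).1 b = exp (recordPhi F θ k K B b.src) * ((recordBgField F θ k K B b : SU 2) : MatA 2) * exp (-recordPhi F θ k K B b.tgt) := fun B b => rfl
  have hP2 : ∀ (B : Fin (F.P K).d → Site (F.P K) (k + 1) → θ.Vβ) (b : PBond (F.P K) 0),
      (recordPairL F θ k K B).2 b = exp (recordPhi F θ k K B b.src) * recordCurrent F θ k K B b * exp (-recordPhi F θ k K B b.src) := fun B b => rfl
  -- Fréchet differentiability of the dressed chart at `0`, coordinate by coordinate
  have hexpd : ∀ x, DifferentiableAt ℝ (fun B : Fin (F.P K).d → Site (F.P K) (k + 1) → θ.Vβ => exp (recordPhi F θ k K B x)) 0 := by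
    intro x
    have h := (NormedSpace.exp_analytic (𝕂 := ℝ) (recordPhi F θ k K 0 x)).differentiableAt
    exact h.comp 0 (differentiableAt_recordPhi F θ k K x 0)
  have hexpd' : ∀ x, DifferentiableAt ℝ (fun B : Fin (F.P K).d → Site (F.P K) (k + 1) → θ.Vβ => exp (-recordPhi F θ k K B x)) 0 := by
    intro x
    have h := (NormedSpace.exp_analytic (𝕂 := ℝ) (-recordPhi F θ k K 0 x)).differentiableAt
    exact h.comp 0 (differentiableAt_recordPhi F θ k K x 0).neg
  have hUdb : ∀ b, DifferentiableAt ℝ (fun B : Fin (F.P K).d → Site (F.P K) (k + 1) → θ.Vβ => ((recordBgField F θ k K B b : SU 2) : MatA 2)) 0 :=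
    fun b => ((hasFDerivAt_pi'.1 hU') b).differentiableAt
  have hP1d : ∀ b, DifferentiableAt ℝ (fun B : Fin (F.P K).d → Site (F.P K) (k + 1) → θ.Vβ => (recordPairL F θ k K B).1 b) 0 := by
    intro b
    simp only [hP1]
    exact ((hexpd b.src).mul (hUdb b)).mul (hexpd' b.tgt)
  have hP2d : ∀ b, DifferentiableAt ℝ (fun B : Fin (F.P K).d → Site (F.P K) (k + 1) → θ.Vβ => (recordPairL F θ k K B).2 b) 0 := by
    intro b
    simp only [hP2]
    exact ((hexpd b.src).mul (hJdiff b)).mul (hexpd' b.src)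
  have hP10 : ∀ b, (recordPairL F θ k K 0).1 b = 1 := fun b => by
    rw [hP1, hΦ0, hΦ0, hbg0, neg_zero, NormedSpace.exp_zero, one_mul, one_mul]
  have hEmbL_d : DifferentiableAt ℝ (recordEmbL F θ k K) 0 := by
    rw [differentiableAt_pi]
    intro j
    obtain ⟨⟨b, t⟩, rfl⟩ := (chartEquivJ F K).surjective j
    rcases t with c | c
    · have hfun : (fun B : Fin (F.P K).d → Site (F.P K) (k + 1) → θ.Vβ => recordEmbL F θ k K B (chartEquivJ F K (b, Sum.inl c))) =
          fun B => sl2Coord (MatrixLog.mlog ((recordPairL F θ k K B).1 b)) c := by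
        funext B; simp [recordEmbL]
      rw [hfun]
      have hm : DifferentiableAt ℝ (MatrixLog.mlog : MatA 2 → MatA 2) ((recordPairL F θ k K 0).1 b) := by
        rw [hP10]; exact hasFDerivAt_mlog_one_real.differentiableAt
      exact DifferentiableAt.comp (g := fun A : MatA 2 => sl2Coord A c) 0 ((contDiff_sl2Coord (n := 1) c).differentiable one_ne_zero).differentiableAt
        (DifferentiableAt.comp (g := (MatrixLog.mlog : MatA 2 → MatA 2)) (f := fun B : Fin (F.P K).d → Site (F.P K) (k + 1) → θ.Vβ => (recordPairL F θ k K B).1 b)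
          0 hm (hP1d b))
    · have hfun : (fun B : Fin (F.P K).d → Site (F.P K) (k + 1) → θ.Vβ => recordEmbL F θ k K B (chartEquivJ F K (b, Sum.inr c))) =
          fun B => sl2Coord ((recordPairL F θ k K B).2 b) c := by
        funext B; simp [recordEmbL]
      rw [hfun]
      exact DifferentiableAt.comp (g := fun A : MatA 2 => sl2Coord A c) (f := fun B : Fin (F.P K).d → Site (F.P K) (k + 1) → θ.Vβ => (recordPairL F θ k K B).2 b)
        0 ((contDiff_sl2Coord (n := 1) c).differentiable one_ne_zero).differentiableAt (hP2d b)
  -- the derivative along the line, read on the coordinate `i`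
  have hEℓ : HasDerivAt (fun t : ℝ => recordEmbL F θ k K (t • δ) i) (fderiv ℝ (recordEmbL F θ k K) 0 δ i) 0 :=
    (hasDerivAt_pi.1 (hEmbL_d.hasFDerivAt.comp_hasDerivAt_of_eq 0 hℓ hℓ0.symm)) i
  -- now compute the same derivative by hand, per coordinate, and compare
  obtain ⟨⟨b, t⟩, rfl⟩ := (chartEquivJ F K).surjective i
  rcases t with c | c
  · -- 𝐔-coordinate
    have hprod : HasDerivAt (fun t : ℝ => (recordPairL F θ k K (t • δ)).1 b)
        (recordPhi F θ k K δ b.src + U' δ b - recordPhi F θ k K δ b.tgt) 0 := by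
      have h := ((hux b.src).mul (hWb b)).mul (huix b.tgt)
      simp only [hP1]
      refine h.congr_deriv ?_
      simp only [Pi.mul_apply, zero_smul, hΦ0, hbg0, neg_zero, NormedSpace.exp_zero, mul_one, one_mul, mul_neg]
      abel
    have hm : HasFDerivAt (MatrixLog.mlog : MatA 2 → MatA 2) (ContinuousLinearMap.id ℝ (MatA 2)) ((recordPairL F θ k K ((0 : ℝ) • δ)).1 b) := by
      rw [zero_smul, hP10]; exact hasFDerivAt_mlog_one_real
    obtain ⟨Lc, hLc, hc⟩ := hasFDerivAt_sl2Coord c (MatrixLog.mlog ((recordPairL F θ k K ((0 : ℝ) • δ)).1 b))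
    have hcomp := hc.comp_hasDerivAt_of_eq 0 (hm.comp_hasDerivAt_of_eq 0 hprod rfl) rfl
    have hfun : (fun t : ℝ => recordEmbL F θ k K (t • δ) (chartEquivJ F K (b, Sum.inl c))) =
        (fun A : MatA 2 => sl2Coord A c) ∘ (MatrixLog.mlog : MatA 2 → MatA 2) ∘ fun t : ℝ => (recordPairL F θ k K (t • δ)).1 b := by
      funext t; simp [recordEmbL]
    rw [hfun] at hEℓ
    have huniq := hEℓ.unique hcomp
    rw [huniq, ContinuousLinearMap.id_apply, hLc, recordGkL_inl, hUD]
    -- `D(b) + φ′(b₋) − φ′(b₊) = Matrix.of (Hr b) + κ•1`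
    set P : Site (F.P K) 0 → MatA 2 := fun x => Matrix.of fun i₁ i₂ => landauPotC F k K (fun b' => recordD F θ k K a l b' i₁ i₂) x with hP
    have hΦP : ∀ x, recordPhi F θ k K δ x = P x - ((P x).trace / 2) • (1 : MatA 2) := by
      intro x
      unfold recordPhi
      rw [sl2Proj_apply]
      have hd : recordDdir F θ k K δ = recordD F θ k K a l := recordDdir_single F θ k K a l
      rw [hd]
    have hHr : (Matrix.of fun i₁ i₂ => recordHr F θ k K a l b i₁ i₂ : MatA 2) =
        (Matrix.of fun i₁ i₂ => recordD F θ k K a l b i₁ i₂) - (P b.tgt - P b.src) := by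
      ext i₁ i₂
      simp only [hP, Matrix.of_apply, Matrix.sub_apply]
      rw [recordD_eq_recordHr_add F θ k K a l b i₁ i₂]
      ring
    rw [hHr, hΦP, hΦP]
    have e : P b.src - ((P b.src).trace / 2) • (1 : MatA 2) + (Matrix.of fun i₁ i₂ => recordD F θ k K a l b i₁ i₂) - (P b.tgt - ((P b.tgt).trace / 2) • (1 : MatA 2)) =
        ((Matrix.of fun i₁ i₂ => recordD F θ k K a l b i₁ i₂) - (P b.tgt - P b.src)) + (((P b.tgt).trace / 2 - (P b.src).trace / 2)) • (1 : MatA 2) := by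
      rw [sub_smul]; abel
    rw [e, sl2Coord_add_smul_one]
  · -- 𝐉-coordinate
    have hprod : HasDerivAt (fun t : ℝ => (recordPairL F θ k K (t • δ)).2 b)
        (fderiv ℝ (fun B : Fin (F.P K).d → Site (F.P K) (k + 1) → θ.Vβ => recordCurrent F θ k K B b) 0 δ) 0 := by
      have h := ((hux b.src).mul (hJℓ b)).mul (huix b.src)
      simp only [hP2]
      refine h.congr_deriv ?_
      simp only [Pi.mul_apply, zero_smul, hΦ0, hcur0, neg_zero, NormedSpace.exp_zero, mul_one, one_mul, mul_zero, zero_mul, add_zero, zero_add]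
    obtain ⟨Lc, hLc, hc⟩ := hasFDerivAt_sl2Coord c ((recordPairL F θ k K ((0 : ℝ) • δ)).2 b)
    have hcomp := hc.comp_hasDerivAt_of_eq 0 hprod rfl
    have hfun : (fun t : ℝ => recordEmbL F θ k K (t • δ) (chartEquivJ F K (b, Sum.inr c))) =
        (fun A : MatA 2 => sl2Coord A c) ∘ fun t : ℝ => (recordPairL F θ k K (t • δ)).2 b := by
      funext t; simp [recordEmbL]
    rw [hfun] at hEℓ
    have huniq := hEℓ.unique hcomp
    rw [huniq, hLc, recordGkL_inr]
    -- the rooted `𝐉`-coordinate derivative along the same line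
    have hEJℓ : HasDerivAt (fun t : ℝ => recordEmbJ F θ k K (t • δ) (chartEquivJ F K (b, Sum.inr c)))
        (fderiv ℝ (recordEmbJ F θ k K) 0 δ (chartEquivJ F K (b, Sum.inr c))) 0 :=
      (hasDerivAt_pi.1 (hE.hasFDerivAt.comp_hasDerivAt_of_eq 0 hℓ hℓ0.symm)) _
    obtain ⟨Lc', hLc', hc'⟩ := hasFDerivAt_sl2Coord c (recordCurrent F θ k K ((0 : ℝ) • δ) b)
    have hcomp' := hc'.comp_hasDerivAt_of_eq 0 (hJℓ b) rfl
    have hfun' : (fun t : ℝ => recordEmbJ F θ k K (t • δ) (chartEquivJ F K (b, Sum.inr c))) =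
        (fun A : MatA 2 => sl2Coord A c) ∘ fun t : ℝ => recordCurrent F θ k K (t • δ) b := by
      funext t; simp [recordEmbJ]
    rw [hfun'] at hEJℓ
    have huniq' := hEJℓ.unique hcomp'
    rw [show recordGkJ F θ k K a l (chartEquivJ F K (b, Sum.inr c)) = fderiv ℝ (recordEmbJ F θ k K) 0 δ (chartEquivJ F K (b, Sum.inr c)) from rfl,
      huniq', hLc']

end Summit.QuantumFields.YangMills.Theorems.PortU8

end
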